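import Summits.QuantumAdvantage.QuantumAdvantage.Theorems.CubicForrelationNearExactIsExactTwelveTypeO932Shape
import Summits.QuantumAdvantage.QuantumAdvantage.Theorems.CubicForrelationNearExactIsExactTwelveTypeO934Wild

/-!
# Crux `CubicForrelation.NearExactIsExact` (stmt-QuantumAdvantage-14043) — n = 12 at `Φ = 932/1024`, type O with base set `960`: the PARTNER is at
  level `≥ 6` (the boundary configuration is a MIXED pair)

Certificate seat `b2b-cforr-cert` (gen 18).  HONEST FRAMING: kernel-checked structure lemmas (standard axioms) for the one rung still open above the
record at `n = 12` (`932/1024 = 233/256`; the tree has `θ₁₂ ∈ [57/64, 932/1024]`).  Nothing is closed here; NO new value of `θ₁₂`.  NOT summit progress.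

* `to18_cubic_weights_eleven_b`: a cubic on 11 bits has weight `0, 256, 384, 448` or `≥ 480` (minimum weight, second weight, and BOTH
  classification-free Kasami–Tokura gaps `kt_gap_cubic`, `kt_gap2_cubic_le_twelve`).
* `to18_char_sum_E960`: if `c` is cubic on 12 bits with `#{c = 1} = 960` then every character sum `Σ_{c(x)=1} (−1)^{x·z}` is `64·m` with
  `m ∈ {0, ±1, ±3, ±7, ±15}` (the two halves along a hyperplane are cubic weights on 11 bits adding up to `960`).
* `to18_typeO_E960_partner`: for a type-O side `g` (`W_g = 16u`, `u` odd) with `#E = 960` and `Φ(f,g) ≥ 932/1024` (so zero excess,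
  `to18_typeO_E960_zero_excess`), the partner identity (`to18_typeO_partner_identity` with `v = 0`) reads
  `64·u_f(y) = 256(−1)^{g(y)} − s_b(4096·[y = c₁] − 4·Ê(c₁ ⊕ y))`, hence `4 ∣ u_f(y)` for every `y`: **the partner `f` is at level `≥ 6`**
  (`W_f ∈ 64ℤ`) — neither type O nor level 5.  With `to18_typeO_le_932`/`tw15_levelFive_932_false` this says: a cubic pair attaining `932/1024`
  through a type-O side of base `960` is a MIXED pair (type O, level `≥ 6`) with `u_f'' = (−1)^g + s_b(Ê/64 − 16·[y = c₁])`, i.e. the level-6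
  residual of `f` vanishes off the 9-flat `c₁ ⊕ {Ê ≠ 0}` and has one spike `|e| = 15` per hyperplane containing `E` — the configuration the
  engine `…Eight735` cannot see because its two-sided kill assumes a level-`≥ 6` partner.  (Paper analysis: HOME/b2b-cforr-cert-g18/PLAN-N12-932.md.)

References: Kasami–Tokura (1970); MacWilliams–Sloane (1977) Ch. 15; Carlet (2021) §5.2.  Axioms: the standard three.
-/

set_option linter.dupNamespace false -- D-0017: single-problem summit ⇒ `QuantumAdvantage.QuantumAdvantage` by design

noncomputable section

namespace Summit.QuantumAdvantage.QuantumAdvantage.Theorems.CubicForrelation.NearExactIsExact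

open Finset
open Literature.Computability.QuantumComplexity
open Literature.Computability.QuantumComplexity.BuzetChailloux (bxor zeroVec bxor_bxor_cancel_left bxor_zeroVec zeroVec_bxor bxor_comm
  bxor_self twist_zeroVec_right twist_bxor_right)
open Literature.Computability.QuantumComplexity.DerivativeWalsh (W)
open Literature.Computability.QuantumComplexity.Simon (twist_eq_one_or)
open Summit.QuantumAdvantage.QuantumAdvantage.Theorems.NearExactIsExact.Negative (TypeOTwelve.typeO_of_exists_odd)

/-! ### Cubic weights on 11 bits below `480` -/

/-- **Cubic weights on 11 bits**: `0, 256, 384, 448` or `≥ 480` (minimum weight `256`, second weight, the Kasami–Tokura gaps `(384, 448)` and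
`(448, 480)` — all classification-free in the tree). [this work] -/
theorem to18_cubic_weights_eleven_b (e : (Fin 11 → Bool) → Bool) (he : IsDegLeFun 3 e) :
    #(univ.filter fun y => e y = true) = 0 ∨ #(univ.filter fun y => e y = true) = 256 ∨
    #(univ.filter fun y => e y = true) = 384 ∨ #(univ.filter fun y => e y = true) = 448 ∨ 480 ≤ #(univ.filter fun y => e y = true) := by
  classical
  rcases to18_cubic_weights_eleven e he with h | h | h | h
  · exact Or.inl h
  · exact Or.inr (Or.inl h)
  · exact Or.inr (Or.inr (Or.inl h))
  · have hg := kt_gap2_cubic_le_twelve 11 (by norm_num) e he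
    norm_num at hg
    omega

/-! ### Character sums of a weight-`960` cubic support -/

/-- **Character sums over a weight-`960` cubic support are `64·m` with `m ∈ {0, ±1, ±3, ±7, ±15}`.**  For `z ≠ 0` the sum is `960 − 2A` where
`A` and `960 − A` are weights of cubics on 11 bits (`ktg_restrict`), so `min ∈ {0, 256, 384, 448, 480}` (`to18_cubic_weights_eleven_b`).
[this work] -/
theorem to18_char_sum_E960 (c : (Fin (6 + 6) → Bool) → Bool) (hc : IsDegLeFun 3 c) (h960 : #(univ.filter fun x => c x = true) = 960)
    (z : Fin (6 + 6) → Bool) :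
    ∃ m : ℤ, (m = 15 ∨ m = 7 ∨ m = 3 ∨ m = 1 ∨ m = 0 ∨ m = -1 ∨ m = -3 ∨ m = -7 ∨ m = -15) ∧
      ∑ x ∈ univ.filter (fun x => c x = true), twist x z = 64 * (m : ℝ) := by
  classical
  have htw : ∀ x : Fin (6 + 6) → Bool, twist x z =
      1 - 2 * (if decide (Odd #(univ.filter fun i => (x i && z i) = true)) = true then (1 : ℝ) else 0) := by
    intro x
    rw [vg_twist_eq_signOf x z]
    unfold signOf
    cases decide (Odd #(univ.filter fun i => (x i && z i) = true)) <;> norm_num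
  set A := #(univ.filter fun x : Fin (6 + 6) → Bool =>
    c x = true ∧ decide (Odd #(univ.filter fun i => (x i && z i) = true)) = true) with hAdef
  set B := #(univ.filter fun x : Fin (6 + 6) → Bool =>
    c x = true ∧ decide (Odd #(univ.filter fun i => (x i && z i) = true)) = false) with hBdef
  have hsum : ∑ x ∈ univ.filter (fun x => c x = true), twist x z = 960 - 2 * (A : ℝ) := by
    rw [sum_congr rfl fun x _ => htw x, sum_sub_distrib, sum_const, h960, ← mul_sum, sum_boole, filter_filter, ← hAdef]
    norm_num
  have hAB : A + B = 960 := by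
    have h := card_filter_add_card_filter_not (s := univ.filter fun x : Fin (6 + 6) → Bool => c x = true)
      (fun x => decide (Odd #(univ.filter fun i => (x i && z i) = true)) = true)
    rw [filter_filter, filter_filter, h960] at h
    have e : (univ.filter fun x : Fin (6 + 6) → Bool =>
        c x = true ∧ ¬ decide (Odd #(univ.filter fun i => (x i && z i) = true)) = true) =
        univ.filter fun x : Fin (6 + 6) → Bool =>
          c x = true ∧ decide (Odd #(univ.filter fun i => (x i && z i) = true)) = false :=
      filter_congr fun x _ => by simp only [Bool.not_eq_true]
    rw [e] at h
    exact h
  rw [hsum]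
  by_cases hz : ∃ i₀, z i₀ = true
  · obtain ⟨i₀, hi₀⟩ := hz
    obtain ⟨cT, hcT, hcardT⟩ := ktg_restrict (k := 11) c hc z i₀ hi₀ true
    obtain ⟨cF, hcF, hcardF⟩ := ktg_restrict (k := 11) c hc z i₀ hi₀ false
    have hA := to18_cubic_weights_eleven_b cT hcT
    have hB := to18_cubic_weights_eleven_b cF hcF
    rw [hcardT] at hA
    rw [hcardF] at hB
    change A = 0 ∨ A = 256 ∨ A = 384 ∨ A = 448 ∨ 480 ≤ A at hA
    change B = 0 ∨ B = 256 ∨ B = 384 ∨ B = 448 ∨ 480 ≤ B at hB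
    have hAval : A = 0 ∨ A = 256 ∨ A = 384 ∨ A = 448 ∨ A = 480 ∨ A = 512 ∨ A = 576 ∨ A = 704 ∨ A = 960 := by omega
    rcases hAval with h | h | h | h | h | h | h | h | h <;> rw [h]
    · exact ⟨15, by norm_num, by norm_num⟩
    · exact ⟨7, by norm_num, by norm_num⟩
    · exact ⟨3, by norm_num, by norm_num⟩
    · exact ⟨1, by norm_num, by norm_num⟩
    · exact ⟨0, by norm_num, by norm_num⟩
    · exact ⟨-1, by norm_num, by norm_num⟩
    · exact ⟨-3, by norm_num, by norm_num⟩
    · exact ⟨-7, by norm_num, by norm_num⟩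
    · exact ⟨-15, by norm_num, by norm_num⟩
  · push Not at hz
    have hA0 : A = 0 := by
      rw [hAdef]
      refine card_eq_zero.2 (filter_eq_empty_iff.2 fun x _ h => ?_)
      have hempty : (univ.filter fun i : Fin (6 + 6) => (x i && z i) = true) = ∅ :=
        filter_eq_empty_iff.2 fun i _ hi => by
          have := hz i
          rw [Bool.and_eq_true] at hi
          rw [hi.2] at this
          exact this rfl
      rw [hempty, card_empty] at h
      simp at h
    rw [hA0]
    exact ⟨15, by norm_num, by norm_num⟩

/-! ### The partner of a type-O side with base set `960` is at level `≥ 6` -/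

/-- **Type O with `#E = 960` at `Φ ≥ 932/1024`: the partner identity with zero excess, and `4 ∣ u_f`.**  For cubic `f, g` with `W_g = 16u`,
some `u` odd, `#E = 960` and `Φ(f,g) ≥ 932/1024`, and `W_f = 16·u_f` (Ax level of the partner): there are `c₁, b₁` with
`(−1)^{d₁(x)} = (−1)^{b₁}(−1)^{c₁·x}` such that for every `y`
`64·u_f(y) = 256·(−1)^{g(y)} − (−1)^{b₁}·(4096·[c₁ ⊕ y = 0] − 4·Ê(c₁ ⊕ y))`, and consequently `4 ∣ u_f(y)` — the partner `f` is at level `≥ 6`.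
NOT summit progress. [this work] -/
theorem to18_typeO_E960_partner (f g : (Fin (6 + 6) → Bool) → Bool) (hg : IsDegLeFun 3 g)
    (u : (Fin (6 + 6) → Bool) → ℤ) (hu : ∀ x, W (fun y => signOf (g y)) x = (2 : ℝ) ^ 4 * (u x : ℝ))
    (hodd : ∃ x, Odd (u x)) (hE : #(univ.filter fun x : Fin (6 + 6) → Bool => (Odd (u x / 2) ↔ Odd (u x / 2 / 2))) = 960)
    (hΦ : (932 / 1024 : ℝ) ≤ forrelation f g)
    (uf : (Fin (6 + 6) → Bool) → ℤ) (huf : ∀ y, W (fun x => signOf (f x)) y = (2 : ℝ) ^ 4 * (uf y : ℝ)) :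
    ∃ (c₁ : Fin (6 + 6) → Bool) (b₁ : Bool), (∀ x, signOf (decide (Odd (u x / 2))) = signOf b₁ * twist c₁ x) ∧
      (∀ y, 64 * (uf y : ℝ) = 256 * signOf (g y) -
        signOf b₁ * ((if bxor c₁ y = (fun _ => false) then (2 : ℝ) ^ (6 + 6) else 0) -
          4 * ∑ x ∈ univ.filter (fun x : Fin (6 + 6) → Bool => (Odd (u x / 2) ↔ Odd (u x / 2 / 2))), twist x (bxor c₁ y))) ∧
      (∀ y, (4 : ℤ) ∣ uf y) := by
  classical
  have hall : ∀ x, Odd (u x) := TypeOTwelve.typeO_of_exists_odd g u hg hu hodd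
  have hu' : ∀ x, W (fun y => signOf (g y)) x = (2 : ℝ) ^ (2 * 2) * (u x : ℝ) := fun x => (hu x).trans (by norm_num)
  have hd1 : IsDegLeFun 1 (fun x => decide (Odd (u x / 2))) := z2_digitOne 2 g u hg hu' hall
  have hd2 : IsDegLeFun 3 (fun x => decide (Odd (u x / 2 / 2))) := z2_digitTwo 2 g u hg hu' hall
  obtain ⟨c₁, b₁, hcb⟩ := stub_affineForm (6 + 6) _ hd1
  set E := univ.filter (fun x : Fin (6 + 6) → Bool => (Odd (u x / 2) ↔ Odd (u x / 2 / 2))) with hEdef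
  -- the base set is a cubic support with `960` points
  have hdegE : IsDegLeFun (2 + 1) (fun x => (decide (Odd (u x / 2)) ^^ decide (Odd (u x / 2 / 2))) ^^ true) :=
    tb_isDegLeFun_xor_const (bb_isDegLeFun_bxor (hd1.mono (by norm_num)) hd2) true
  have hsetE : (univ.filter fun x : Fin (6 + 6) → Bool =>
      ((decide (Odd (u x / 2)) ^^ decide (Odd (u x / 2 / 2))) ^^ true) = true) = E := by
    rw [hEdef]
    apply filter_congr
    intro x _
    by_cases h1 : Odd (u x / 2) <;> by_cases h2 : Odd (u x / 2 / 2) <;> simp [h1, h2]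
  -- zero excess: `v = 0` in the partner identity
  obtain ⟨hτ, -⟩ := to18_typeO_E960_zero_excess f g hg u hu hodd (by rw [← hEdef]; exact hE) hΦ
  have hv : ∀ x, u x - 4 * sZ (f x) =
      sZ (decide (Odd (u x / 2))) * (1 - 4 * (if (Odd (u x / 2) ↔ Odd (u x / 2 / 2)) then 1 else 0)) + 8 * (fun _ => (0 : ℤ)) x := by
    intro x; rw [hτ x]; ring
  have hid : ∀ y, 64 * (uf y : ℝ) = 256 * signOf (g y) -
      signOf b₁ * ((if bxor c₁ y = (fun _ => false) then (2 : ℝ) ^ (6 + 6) else 0) - 4 * ∑ x ∈ E, twist x (bxor c₁ y)) := by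
    intro y
    have h := to18_typeO_partner_identity f g u hu (fun _ => (0 : ℤ)) hv c₁ b₁ hcb uf huf y
    rw [← hEdef] at h
    have h0 : ∑ x : Fin (6 + 6) → Bool, (((fun _ => (0 : ℤ)) x : ℤ) : ℝ) * twist x y = 0 := by
      simp
    rw [h0, mul_zero, sub_zero] at h
    exact h
  refine ⟨c₁, b₁, hcb, hid, fun y => ?_⟩
  have hsb : signOf b₁ = 1 ∨ signOf b₁ = -1 := by cases b₁ <;> simp [signOf]
  have hsg : signOf (g y) = 1 ∨ signOf (g y) = -1 := by cases g y <;> simp [signOf]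
  have h := hid y
  by_cases hz : bxor c₁ y = (fun _ => false)
  · -- `y = c₁`: `Ê(0) = 960`
    rw [if_pos hz] at h
    have hS : ∑ x ∈ E, twist x (bxor c₁ y) = 960 := by
      rw [hz, show (fun _ : Fin (6 + 6) => false) = (zeroVec : Fin (6 + 6) → Bool) from rfl,
        sum_congr rfl fun x _ => twist_zeroVec_right x, sum_const]
      rw [show #E = 960 from hE]; norm_num
    rw [hS] at h
    -- `64 u_f = 256 sg − 256 sb`
    have e256 : ((2 : ℝ) ^ (6 + 6) - 4 * 960) = 256 := by norm_num
    rw [e256] at h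
    have h' : (uf y : ℝ) = 4 * signOf (g y) - 4 * signOf b₁ := by linarith
    have hZ : uf y = 4 * sZ (g y) - 4 * sZ b₁ := by
      have e : ((uf y : ℤ) : ℝ) = ((4 * sZ (g y) - 4 * sZ b₁ : ℤ) : ℝ) := by push_cast; rw [tp_sZ_cast, tp_sZ_cast]; exact h'
      exact_mod_cast e
    exact ⟨sZ (g y) - sZ b₁, by rw [hZ]; ring⟩
  · rw [if_neg hz] at h
    obtain ⟨m, -, hm⟩ := to18_char_sum_E960 _ hdegE (by rw [hsetE]; exact hE) (bxor c₁ y)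
    rw [hsetE] at hm
    rw [hm] at h
    have h' : (uf y : ℝ) = 4 * signOf (g y) + 4 * signOf b₁ * m := by linarith
    have hZ : uf y = 4 * sZ (g y) + 4 * sZ b₁ * m := by
      have e : ((uf y : ℤ) : ℝ) = ((4 * sZ (g y) + 4 * sZ b₁ * m : ℤ) : ℝ) := by push_cast; rw [tp_sZ_cast, tp_sZ_cast]; exact h'
      exact_mod_cast e
    exact ⟨sZ (g y) + sZ b₁ * m, by rw [hZ]; ring⟩

/-- **Corollary: in a `932/1024`-pair with a type-O side of base `960`, the partner is at level `≥ 6`** — every `W_f(y)/16` is even (indeed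
`≡ 0 mod 4`), so `f` is neither type O nor (`tw_level_up` twice) at level 5.  NOT summit progress. [this work] -/
theorem to18_typeO_E960_partner_even (f g : (Fin (6 + 6) → Bool) → Bool) (hg : IsDegLeFun 3 g)
    (u : (Fin (6 + 6) → Bool) → ℤ) (hu : ∀ x, W (fun y => signOf (g y)) x = (2 : ℝ) ^ 4 * (u x : ℝ))
    (hodd : ∃ x, Odd (u x)) (hE : #(univ.filter fun x : Fin (6 + 6) → Bool => (Odd (u x / 2) ↔ Odd (u x / 2 / 2))) = 960)
    (hΦ : (932 / 1024 : ℝ) ≤ forrelation f g)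
    (uf : (Fin (6 + 6) → Bool) → ℤ) (huf : ∀ y, W (fun x => signOf (f x)) y = (2 : ℝ) ^ 4 * (uf y : ℝ)) :
    (∀ y, ¬ Odd (uf y)) ∧ (∀ y, ¬ Odd (uf y / 2)) := by
  obtain ⟨c₁, b₁, -, -, h4⟩ := to18_typeO_E960_partner f g hg u hu hodd hE hΦ uf huf
  constructor
  · intro y hy
    obtain ⟨k, hk⟩ := h4 y
    rw [hk] at hy
    exact (Int.not_even_iff_odd.2 hy) ⟨2 * k, by ring⟩
  · intro y hy
    obtain ⟨k, hk⟩ := h4 y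
    rw [hk, show (4 : ℤ) * k = 2 * (2 * k) by ring, Int.mul_ediv_cancel_left _ two_ne_zero] at hy
    exact (Int.not_even_iff_odd.2 hy) ⟨k, by ring⟩

end Summit.QuantumAdvantage.QuantumAdvantage.Theorems.CubicForrelation.NearExactIsExact

end
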